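import Summits.AtomisticToContinuum.HydrodynamicLimit.Theorems.InformationPercolationEngineCollisionRate
import Summits.AtomisticToContinuum.HydrodynamicLimit.Theorems.JParityClosureEvenStressEnskogL2ToProbability
import Summits.AtomisticToContinuum.HydrodynamicLimit.Theorems.InformationPercolationEngineCollisionRateTubeRegular
import Summits.AtomisticToContinuum.HydrodynamicLimit.Theorems.InformationPercolationEngineCollisionRateUnitMarkTruncationRung0
import Summits.AtomisticToContinuum.HydrodynamicLimit.Theorems.InformationPercolationEngineCollisionRateCylinderPullbackUnitRung0
import Summits.AtomisticToContinuum.HydrodynamicLimit.Theorems.InformationPercolationEngineCollisionRateMeanEnskogUnitRung0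
import Summits.AtomisticToContinuum.HydrodynamicLimit.Theorems.InformationPercolationEngineCollisionRateFixedTimeVarianceUnitRung0
import HarnessLib

/-!
# The rung-0 closure of `InformationPercolationEngine.CollisionRate` (stmt-AtomisticToContinuum-13481) modulo the decorrelation plateau

Line `Sketch` of the crux, lead c1 (prover-line-stmt-AtomisticToContinuum-13481-c1-0), 2026-08-16.  `CollisionRate` — the Enskog
collision-frequency law for deterministic hard spheres at fixed reduced density — is `evenStat` at the constant mark
(`Theorems.CollisionRate.collisionRate_iff_evenStat_one`).  AT CONSTANT PROFILES (global equilibrium: the local Gibbs law is the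
flow-invariant canonical Gibbs law) it follows from the four unit-mark rung-0 stubs of the line, all LANDED — R1
`stub_unitMarkTruncationRung0` (p112143), R2 `stub_cylinderPullbackUnitRung0` (p118935), R3 `stub_meanEnskogUnitRung0` (p121619,
unconditional: the contact theorem is the tree theorem `HardSphereContactTheorem_holds`), R4 `stub_fixedTimeVarianceUnitRung0` (p123333,
modulo Plateau′) — through the composition `evenStatOne_rung0_of` (the sibling's `Theorems.EvenStressEnskog.EvenStressEnskog_rung0_of`
transcribed to the pair of marks `(1, Ξ₁ᴸ)`, `Ξ₁ᴸ := fun q => speedCutoff L ‖q.2.2 − q.2.1‖`, with the abstract Chebyshev-in-time step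
`Theorems.EvenStressEnskog.stub_l2ToProbability` and the mark-1 regularity `Theorems.CollisionRate.evenTubeStatRegular_one`).  Result:
`collisionRateConst_of_plateau : Plateau′ → CollisionRate|const` — the crux at global equilibrium conditional on ONE static
cluster-expansion input, the decorrelation plateau of two disjoint decorated dimers under the canonical configurational measure,
shared verbatim with the sibling crux `JParityClosure.EvenStressEnskog` (`EvenStressEnskog_rung0_of_plateau_contact`, p98509).
-/


namespace Summit.AtomisticToContinuum.HydrodynamicLimit.Theorems.CollisionRate

open Summit.AtomisticToContinuum.HydrodynamicLimit.Theses.InformationPercolationEngine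
open scoped BigOperators Topology Classical MeasureTheory ProbabilityTheory InnerProductSpace ENNReal
open Filter Set Function MeasureTheory
open Literature.Analysis.FluidPDE Literature.MathematicalPhysics.KineticTheory

noncomputable section

/-- **The rung-0 composition at the unit mark** (`Theorems.EvenStressEnskog.EvenStressEnskog_rung0_of` transcribed to the pair of
marks `(1, Ξ₁ᴸ)`): unit-mark truncation (R1) → cylinder pull-back (R2) → time-integrated mean (R3) → fixed-time variance (conclusion of R4) →
`CollisionRate` at constant profiles, through the abstract Chebyshev-in-time step `Theorems.EvenStressEnskog.stub_l2ToProbability` and the mark-1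
regularity `Theorems.CollisionRate.evenTubeStatRegular_one`; thresholds `η₀ := min`, `σ₀ := min ∧ 1/2`, accuracies `(η/3, δ/3)`, mean `η/6`,
variance `δ/3·(η/6)²/τ²`, `L := max L₀ 1`, `κ := min (κ₂/2) (κ₃/2) ∧ 1`, union bound. [folklore] -/
theorem evenStatOne_rung0_of
    (hS1 : ∃ η₀ : ℝ, 0 < η₀ ∧ ∀ (ab θb : ℝ) (ub : V3), 0 < ab → 0 < θb → ∃ σ₀ : ℝ, 0 < σ₀ ∧ ∀ σ : ℝ, 0 < σ → σ < σ₀ →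
      ∀ Φ : (N : ℕ) → HardSphereFlow (Torus.geometry (Fin 3)) (hsDiameter σ N) (N + 1),
      ∀ τ : ℝ, 0 < τ → ∀ χ : ℝ × T3 → ℝ, Continuous χ → ∀ g : ℝ → ℝ, Continuous g →
      (∀ x, η₀ ≤ x → g x = 0) →
      ∀ η δ : ℝ, 0 < η → 0 < δ → ∃ r₀ : ℝ, 0 < r₀ ∧ ∀ r : ℝ, 0 < r → r < r₀ →
      ∃ L₀ : ℝ, ∀ L : ℝ, L₀ ≤ L → ∃ N₀ : ℕ, ∀ N : ℕ, N₀ ≤ N →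
        localGibbsLaw σ (fun _ => ab) (fun _ => ub) (fun _ => θb) N (Φ N)
          {z | η < |evenStat σ N (Φ N) τ χ g (fun _ => 1) r z -
              evenStat σ N (Φ N) τ χ g (fun q : V3 × V3 × V3 => speedCutoff L ‖q.2.2 - q.2.1‖) r z|}
          ≤ ENNReal.ofReal δ)
    (hS2 : ∃ η₀ : ℝ, 0 < η₀ ∧ ∀ (ab θb : ℝ) (ub : V3), 0 < ab → 0 < θb → ∃ σ₀ : ℝ, 0 < σ₀ ∧ ∀ σ : ℝ, 0 < σ → σ < σ₀ →
      ∀ Φ : (N : ℕ) → HardSphereFlow (Torus.geometry (Fin 3)) (hsDiameter σ N) (N + 1),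
      ∀ τ : ℝ, 0 < τ → ∀ χ : ℝ × T3 → ℝ, Continuous χ → ∀ g : ℝ → ℝ, Continuous g →
      (∀ x, η₀ ≤ x → g x = 0) →
      ∀ η δ : ℝ, 0 < η → 0 < δ → ∃ r₀ : ℝ, 0 < r₀ ∧ ∀ r : ℝ, 0 < r → r < r₀ →
      ∀ L : ℝ, 1 ≤ L → ∃ κ₀ : ℝ, 0 < κ₀ ∧ ∀ κ : ℝ, 0 < κ → κ < κ₀ → ∃ N₀ : ℕ, ∀ N : ℕ, N₀ ≤ N →
        localGibbsLaw σ (fun _ => ab) (fun _ => ub) (fun _ => θb) N (Φ N)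
          {z | η < |evenStat σ N (Φ N) τ χ g (fun q : V3 × V3 × V3 => speedCutoff L ‖q.2.2 - q.2.1‖) r z -
              evenTubeTimeStat σ N (Φ N) τ χ g (fun q : V3 × V3 × V3 => speedCutoff L ‖q.2.2 - q.2.1‖) r κ z|}
          ≤ ENNReal.ofReal δ)
    (hS3 : ∃ η₀ : ℝ, 0 < η₀ ∧ ∀ (ab θb : ℝ) (ub : V3), 0 < ab → 0 < θb → ∃ σ₀ : ℝ, 0 < σ₀ ∧ ∀ σ : ℝ, 0 < σ → σ < σ₀ →
      ∀ Φ : (N : ℕ) → HardSphereFlow (Torus.geometry (Fin 3)) (hsDiameter σ N) (N + 1),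
      ∀ τ : ℝ, 0 < τ → ∀ χ : ℝ × T3 → ℝ, Continuous χ → ∀ g : ℝ → ℝ, Continuous g →
      (∀ x, η₀ ≤ x → g x = 0) →
      ∀ η : ℝ, 0 < η → ∃ r₀ : ℝ, 0 < r₀ ∧ ∀ r : ℝ, 0 < r → r < r₀ →
      ∀ L : ℝ, 1 ≤ L → ∃ κ₀ : ℝ, 0 < κ₀ ∧ ∀ κ : ℝ, 0 < κ → κ < κ₀ → ∃ N₀ : ℕ, ∀ N : ℕ, N₀ ≤ N →
        |∫ t in Set.Icc (0 : ℝ) τ,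
            ∫ z, evenTubeStat σ N χ g (fun q : V3 × V3 × V3 => speedCutoff L ‖q.2.2 - q.2.1‖) r κ t ((Φ N).flow t z)
              ∂(localGibbsLaw σ (fun _ => ab) (fun _ => ub) (fun _ => θb) N (Φ N))| ≤ η)
    (hS4 : ∃ η₀ : ℝ, 0 < η₀ ∧ ∀ (ab θb : ℝ) (ub : V3), 0 < ab → 0 < θb → ∃ σ₀ : ℝ, 0 < σ₀ ∧ ∀ σ : ℝ, 0 < σ → σ < σ₀ →
      ∀ Φ : (N : ℕ) → HardSphereFlow (Torus.geometry (Fin 3)) (hsDiameter σ N) (N + 1),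
      ∀ τ : ℝ, 0 < τ → ∀ χ : ℝ × T3 → ℝ, Continuous χ → ∀ g : ℝ → ℝ, Continuous g →
      (∀ x, η₀ ≤ x → g x = 0) →
      ∀ ς : ℝ, 0 < ς → ∃ r₀ : ℝ, 0 < r₀ ∧ ∀ r : ℝ, 0 < r → r < r₀ →
      ∀ L κ : ℝ, 1 ≤ L → 0 < κ → κ ≤ 1 → ∃ N₀ : ℕ, ∀ N : ℕ, N₀ ≤ N → ∀ t ∈ Set.Icc (0 : ℝ) τ,
        ProbabilityTheory.variance
          (fun z => evenTubeStat σ N χ g (fun q : V3 × V3 × V3 => speedCutoff L ‖q.2.2 - q.2.1‖) r κ t ((Φ N).flow t z))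
          (localGibbsLaw σ (fun _ => ab) (fun _ => ub) (fun _ => θb) N (Φ N)) ≤ ς) :
    ∃ η₀ : ℝ, 0 < η₀ ∧ ∀ (ab θb : ℝ) (ub : V3), 0 < ab → 0 < θb → ∃ σ₀ : ℝ, 0 < σ₀ ∧ ∀ σ : ℝ, 0 < σ → σ < σ₀ →
      ∀ Φ : (N : ℕ) → HardSphereFlow (Torus.geometry (Fin 3)) (hsDiameter σ N) (N + 1),
      ∀ τ : ℝ, 0 < τ → ∀ χ : ℝ × T3 → ℝ, Continuous χ → ∀ g : ℝ → ℝ, Continuous g →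
      (∀ x, η₀ ≤ x → g x = 0) →
      ∀ η δ : ℝ, 0 < η → 0 < δ → ∃ r₀ : ℝ, 0 < r₀ ∧ ∀ r : ℝ, 0 < r → r < r₀ →
      ∃ N₀ : ℕ, ∀ N : ℕ, N₀ ≤ N →
        localGibbsLaw σ (fun _ => ab) (fun _ => ub) (fun _ => θb) N (Φ N) {z | η < |evenStat σ N (Φ N) τ χ g (fun _ => 1) r z|}
          ≤ ENNReal.ofReal δ := by
  have hS5 := @Summit.AtomisticToContinuum.HydrodynamicLimit.Theorems.EvenStressEnskog.stub_l2ToProbability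
  have hS6 := Summit.AtomisticToContinuum.HydrodynamicLimit.Theorems.CollisionRate.evenTubeStatRegular_one
  obtain ⟨η₁, hη₁, H1⟩ := hS1
  obtain ⟨η₂, hη₂, H2⟩ := hS2
  obtain ⟨η₃, hη₃, H3⟩ := hS3
  obtain ⟨η₄, hη₄, H4⟩ := hS4
  obtain ⟨η₆, hη₆, H6⟩ := hS6
  refine ⟨min (min (min η₁ η₂) (min η₃ η₄)) η₆,
    lt_min (lt_min (lt_min hη₁ hη₂) (lt_min hη₃ hη₄)) hη₆, ?_⟩
  intro a θ u ha0 hθ0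
  obtain ⟨σ₁, hσ₁, H1⟩ := H1 a θ u ha0 hθ0
  obtain ⟨σ₂, hσ₂, H2⟩ := H2 a θ u ha0 hθ0
  obtain ⟨σ₃, hσ₃, H3⟩ := H3 a θ u ha0 hθ0
  obtain ⟨σ₄, hσ₄, H4⟩ := H4 a θ u ha0 hθ0
  refine ⟨min (min (min σ₁ σ₂) (min σ₃ σ₄)) (1 / 2),
    lt_min (lt_min (lt_min hσ₁ hσ₂) (lt_min hσ₃ hσ₄)) (by norm_num), ?_⟩
  intro σ hσ hσlt' Φ τ hτ χ hχ g hg hg0 η δ hη hδ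
  have hσlt : σ < min (min σ₁ σ₂) (min σ₃ σ₄) := lt_of_lt_of_le hσlt' (min_le_left _ _)
  have hσhalf : σ ≤ 1 / 2 := (lt_of_lt_of_le hσlt' (min_le_right _ _)).le
  have hσ1 : σ < σ₁ := lt_of_lt_of_le hσlt ((min_le_left _ _).trans (min_le_left _ _))
  have hσ2 : σ < σ₂ := lt_of_lt_of_le hσlt ((min_le_left _ _).trans (min_le_right _ _))
  have hσ3 : σ < σ₃ := lt_of_lt_of_le hσlt ((min_le_right _ _).trans (min_le_left _ _))
  have hσ4 : σ < σ₄ := lt_of_lt_of_le hσlt ((min_le_right _ _).trans (min_le_right _ _))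
  -- the cutoff vanishes above each threshold
  have hmin₁ : min (min (min η₁ η₂) (min η₃ η₄)) η₆ ≤ η₁ :=
    ((min_le_left _ _).trans (min_le_left _ _)).trans (min_le_left _ _)
  have hmin₂ : min (min (min η₁ η₂) (min η₃ η₄)) η₆ ≤ η₂ :=
    ((min_le_left _ _).trans (min_le_left _ _)).trans (min_le_right _ _)
  have hmin₃ : min (min (min η₁ η₂) (min η₃ η₄)) η₆ ≤ η₃ :=
    ((min_le_left _ _).trans (min_le_right _ _)).trans (min_le_left _ _)
  have hmin₄ : min (min (min η₁ η₂) (min η₃ η₄)) η₆ ≤ η₄ :=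
    ((min_le_left _ _).trans (min_le_right _ _)).trans (min_le_right _ _)
  have hmin₆ : min (min (min η₁ η₂) (min η₃ η₄)) η₆ ≤ η₆ := min_le_right _ _
  have hg1 : ∀ x, η₁ ≤ x → g x = 0 := fun x h => hg0 x (hmin₁.trans h)
  have hg2 : ∀ x, η₂ ≤ x → g x = 0 := fun x h => hg0 x (hmin₂.trans h)
  have hg3 : ∀ x, η₃ ≤ x → g x = 0 := fun x h => hg0 x (hmin₃.trans h)
  have hg4 : ∀ x, η₄ ≤ x → g x = 0 := fun x h => hg0 x (hmin₄.trans h)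
  have hg6 : ∀ x, η₆ ≤ x → g x = 0 := fun x h => hg0 x (hmin₆.trans h)
  -- accuracies
  have hη3 : 0 < η / 3 := by positivity
  have hδ3 : 0 < δ / 3 := by positivity
  have hη6 : 0 < η / 6 := by positivity
  have hς : 0 < δ / 3 * (η / 6) ^ 2 / τ ^ 2 := by positivity
  obtain ⟨r₁, hr₁, H1⟩ := H1 σ hσ hσ1 Φ τ hτ χ hχ g hg hg1 (η / 3) (δ / 3) hη3 hδ3
  obtain ⟨r₂, hr₂, H2⟩ := H2 σ hσ hσ2 Φ τ hτ χ hχ g hg hg2 (η / 3) (δ / 3) hη3 hδ3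
  obtain ⟨r₃, hr₃, H3⟩ := H3 σ hσ hσ3 Φ τ hτ χ hχ g hg hg3 (η / 6) hη6
  obtain ⟨r₄, hr₄, H4⟩ := H4 σ hσ hσ4 Φ τ hτ χ hχ g hg hg4 (δ / 3 * (η / 6) ^ 2 / τ ^ 2) hς
  refine ⟨min (min r₁ r₂) (min r₃ r₄), lt_min (lt_min hr₁ hr₂) (lt_min hr₃ hr₄), ?_⟩
  intro r hr hrlt
  have hr1 : r < r₁ := lt_of_lt_of_le hrlt ((min_le_left _ _).trans (min_le_left _ _))
  have hr2 : r < r₂ := lt_of_lt_of_le hrlt ((min_le_left _ _).trans (min_le_right _ _))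
  have hr3 : r < r₃ := lt_of_lt_of_le hrlt ((min_le_right _ _).trans (min_le_left _ _))
  have hr4 : r < r₄ := lt_of_lt_of_le hrlt ((min_le_right _ _).trans (min_le_right _ _))
  -- truncation level (R1)
  obtain ⟨L₀, H1⟩ := H1 r hr hr1
  have hL₀ : L₀ ≤ max L₀ 1 := le_max_left _ _
  have hL1 : (1 : ℝ) ≤ max L₀ 1 := le_max_right _ _
  have hLpos : (0 : ℝ) < max L₀ 1 := one_pos.trans_le hL1
  obtain ⟨N₁, H1⟩ := H1 (max L₀ 1) hL₀
  -- flight-time window (R2 and R3 each give a κ₀)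
  obtain ⟨κ₂, hκ₂, H2⟩ := H2 r hr hr2 (max L₀ 1) hL1
  obtain ⟨κ₃, hκ₃, H3⟩ := H3 r hr hr3 (max L₀ 1) hL1
  have hκpos : (0 : ℝ) < min (min (κ₂ / 2) (κ₃ / 2)) 1 := lt_min (lt_min (by positivity) (by positivity)) one_pos
  have hκlt2 : min (min (κ₂ / 2) (κ₃ / 2)) 1 < κ₂ :=
    lt_of_le_of_lt ((min_le_left _ _).trans (min_le_left _ _)) (by linarith)
  have hκlt3 : min (min (κ₂ / 2) (κ₃ / 2)) 1 < κ₃ :=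
    lt_of_le_of_lt ((min_le_left _ _).trans (min_le_right _ _)) (by linarith)
  have hκ1 : min (min (κ₂ / 2) (κ₃ / 2)) 1 ≤ (1 : ℝ) := min_le_right _ _
  obtain ⟨N₂, H2⟩ := H2 (min (min (κ₂ / 2) (κ₃ / 2)) 1) hκpos hκlt2
  obtain ⟨N₃, H3⟩ := H3 (min (min (κ₂ / 2) (κ₃ / 2)) 1) hκpos hκlt3
  obtain ⟨N₄, H4⟩ := H4 r hr hr4 (max L₀ 1) (min (min (κ₂ / 2) (κ₃ / 2)) 1) hL1 hκpos hκ1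
  refine ⟨max (max N₁ N₂) (max N₃ N₄), fun N hN => ?_⟩
  have hN1 : N₁ ≤ N := ((le_max_left _ _).trans (le_max_left _ _)).trans hN
  have hN2 : N₂ ≤ N := ((le_max_right _ _).trans (le_max_left _ _)).trans hN
  have hN3 : N₃ ≤ N := ((le_max_left _ _).trans (le_max_right _ _)).trans hN
  have hN4 : N₄ ≤ N := ((le_max_right _ _).trans (le_max_right _ _)).trans hN
  have E1 := H1 N hN1
  have E2 := H2 N hN2
  have E3 := H3 N hN3
  have E4 : ∀ t ∈ Set.Icc (0 : ℝ) τ,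
      ProbabilityTheory.variance
        (fun z => evenTubeStat σ N χ g (fun q : V3 × V3 × V3 => speedCutoff (max L₀ 1) ‖q.2.2 - q.2.1‖) r
          (min (min (κ₂ / 2) (κ₃ / 2)) 1) t ((Φ N).flow t z))
        (localGibbsLaw σ (fun _ => a) (fun _ => u) (fun _ => θ) N (Φ N)) ≤ δ / 3 * (η / 6) ^ 2 / τ ^ 2 :=
    fun t ht => H4 N hN4 t ht
  -- regularity of W (S6 at the unit mark) and the probability law, fed into S5
  obtain ⟨hmeas, B, hB⟩ := H6 σ N χ g (max L₀ 1) r (min (min (κ₂ / 2) (κ₃ / 2)) 1) τ hσ hχ hg hg6 hLpos hr hκpos.le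
  have hPN : IsProbabilityMeasure (localGibbsLaw σ (fun _ => a) (fun _ => u) (fun _ => θ) N (Φ N)) :=
    isProbabilityMeasure_localGibbsLaw continuous_const continuous_const continuous_const (fun _ => ha0) (fun _ => hθ0)
      hσhalf N (Φ N)
  have E5 := hS5 σ (fun _ => a) (fun _ => θ) (fun _ => u) N (Φ N) τ
    (fun t z => evenTubeStat σ N χ g (fun q : V3 × V3 × V3 => speedCutoff (max L₀ 1) ‖q.2.2 - q.2.1‖) r
      (min (min (κ₂ / 2) (κ₃ / 2)) 1) t z)
    (η / 6) (δ / 3 * (η / 6) ^ 2 / τ ^ 2) (η / 3) B hPN hmeas hB hτ hς.le (by linarith) E3 E4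
  have hval : τ ^ 2 * (δ / 3 * (η / 6) ^ 2 / τ ^ 2) / (η / 3 - η / 6) ^ 2 = δ / 3 := by
    field_simp
    ring
  rw [hval] at E5
  -- the union bound
  set P := localGibbsLaw σ (fun _ => a) (fun _ => u) (fun _ => θ) N (Φ N) with hP
  set D := fun z => evenStat σ N (Φ N) τ χ g (fun _ => 1) r z with hD
  set DL := fun z => evenStat σ N (Φ N) τ χ g (fun q : V3 × V3 × V3 => speedCutoff (max L₀ 1) ‖q.2.2 - q.2.1‖) r z
    with hDL
  set T := fun z => evenTubeTimeStat σ N (Φ N) τ χ g (fun q : V3 × V3 × V3 => speedCutoff (max L₀ 1) ‖q.2.2 - q.2.1‖) r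
    (min (min (κ₂ / 2) (κ₃ / 2)) 1) z with hT
  have E5' : P {z | η / 3 < |T z|} ≤ ENNReal.ofReal (δ / 3) := E5
  have hsub : {z | η < |D z|} ⊆
      ({z | η / 3 < |D z - DL z|} ∪ {z | η / 3 < |DL z - T z|}) ∪ {z | η / 3 < |T z|} := by
    intro z hz
    simp only [Set.mem_setOf_eq, Set.mem_union] at hz ⊢
    by_contra hcon
    simp only [not_or, not_lt] at hcon
    obtain ⟨⟨h1, h2⟩, h3⟩ := hcon
    have i1 := abs_sub_abs_le_abs_sub (D z) (DL z)
    have i2 := abs_sub_abs_le_abs_sub (DL z) (T z)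
    linarith
  calc P {z | η < |D z|}
      ≤ P (({z | η / 3 < |D z - DL z|} ∪ {z | η / 3 < |DL z - T z|}) ∪ {z | η / 3 < |T z|}) :=
        measure_mono hsub
    _ ≤ P ({z | η / 3 < |D z - DL z|} ∪ {z | η / 3 < |DL z - T z|}) + P {z | η / 3 < |T z|} :=
        measure_union_le _ _
    _ ≤ (P {z | η / 3 < |D z - DL z|} + P {z | η / 3 < |DL z - T z|}) + P {z | η / 3 < |T z|} :=
        add_le_add (measure_union_le _ _) le_rfl
    _ ≤ (ENNReal.ofReal (δ / 3) + ENNReal.ofReal (δ / 3)) + ENNReal.ofReal (δ / 3) :=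
        add_le_add (add_le_add E1 E2) E5'
    _ = ENNReal.ofReal δ := by
        rw [← ENNReal.ofReal_add hδ3.le hδ3.le, ← ENNReal.ofReal_add (by positivity) hδ3.le]
        congr 1
        ring

/-- **`CollisionRate` AT GLOBAL EQUILIBRIUM, MODULO THE DECORRELATION PLATEAU.**  For constant profiles `(ā, ū, θ̄)` the crux
`InformationPercolationEngine.CollisionRate` — in its `evenStat`-at-the-unit-mark frame (`collisionRate_iff_evenStat_one`): for a universal `η₀ > 0`,
`σ < σ₀`, every flow family, horizon `τ`, localiser `χ`, cutoff `g` vanishing on `[η₀, ∞)` and `η, δ > 0`, eventually in `r → 0` then `N → ∞`,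
`G_N(η < |K_N[χ g(σ³ρ_r)] − σ³∫∫ χ g Y(σ³ρ_r) B¹_r|) ≤ δ` under the canonical law — follows from Plateau′, the relative asymptotic independence of
two disjoint decorated dimers under the canonical configurational measure `posGibbsMeasure 1 ε_N (N+1)` (verbatim the hypothesis of
`Theorems.EvenStressEnskog.EvenStressEnskog_rung0_of_plateau_contact`; the contact theorem there is now the tree theorem
`HardSphereContactTheorem_holds`).  Assembled from the four landed unit-mark rung-0 stubs of line `Sketch` (p112143, p118935, p121619, p123333).
[folklore] -/
theorem collisionRateConst_of_plateau :
    (∃ σ₁ : ℝ, 0 < σ₁ ∧ ∀ σ : ℝ, 0 < σ → σ < σ₁ → ∀ ζ : ℝ, 0 < ζ → ∃ N₀ : ℕ, ∀ N : ℕ, N₀ ≤ N →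
      ∀ i j k l : Fin (N + 1), i ≠ j → i ≠ k → i ≠ l → j ≠ k → j ≠ l → k ≠ l →
      ∀ (h h' : T3 → ℝ), Measurable h → Measurable h' → (∀ y, |h y| ≤ 1) → (∀ y, |h' y| ≤ 1) →
      ∀ T T' : Set T3, MeasurableSet T → MeasurableSet T' →
        |(∫ x, h (x i) * T.indicator (fun _ => (1 : ℝ)) (x j - x i) * (h' (x k) * T'.indicator (fun _ => (1 : ℝ)) (x l - x k))
            ∂posGibbsMeasure (fun _ : T3 => (1 : ℝ)) (hsDiameter σ N) (N + 1)) -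
          (∫ x, h (x i) * T.indicator (fun _ => (1 : ℝ)) (x j - x i)
            ∂posGibbsMeasure (fun _ : T3 => (1 : ℝ)) (hsDiameter σ N) (N + 1)) *
          (∫ x, h' (x k) * T'.indicator (fun _ => (1 : ℝ)) (x l - x k)
            ∂posGibbsMeasure (fun _ : T3 => (1 : ℝ)) (hsDiameter σ N) (N + 1))| ≤
        ζ * (MeasureTheory.volume T).toReal * (MeasureTheory.volume T').toReal) →
    ∃ η₀ : ℝ, 0 < η₀ ∧ ∀ (ab θb : ℝ) (ub : V3), 0 < ab → 0 < θb → ∃ σ₀ : ℝ, 0 < σ₀ ∧ ∀ σ : ℝ, 0 < σ → σ < σ₀ →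
      ∀ Φ : (N : ℕ) → HardSphereFlow (Torus.geometry (Fin 3)) (hsDiameter σ N) (N + 1),
      ∀ τ : ℝ, 0 < τ → ∀ χ : ℝ × T3 → ℝ, Continuous χ → ∀ g : ℝ → ℝ, Continuous g →
      (∀ x, η₀ ≤ x → g x = 0) →
      ∀ η δ : ℝ, 0 < η → 0 < δ → ∃ r₀ : ℝ, 0 < r₀ ∧ ∀ r : ℝ, 0 < r → r < r₀ →
      ∃ N₀ : ℕ, ∀ N : ℕ, N₀ ≤ N →
        localGibbsLaw σ (fun _ => ab) (fun _ => ub) (fun _ => θb) N (Φ N) {z | η < |evenStat σ N (Φ N) τ χ g (fun _ => 1) r z|}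
          ≤ ENNReal.ofReal δ :=
  fun hPl => evenStatOne_rung0_of Summit.AtomisticToContinuum.HydrodynamicLimit.Theorems.CollisionRate.stub_unitMarkTruncationRung0 Summit.AtomisticToContinuum.HydrodynamicLimit.Theorems.CollisionRate.stub_cylinderPullbackUnitRung0
    Summit.AtomisticToContinuum.HydrodynamicLimit.Theorems.CollisionRate.stub_meanEnskogUnitRung0 (Summit.AtomisticToContinuum.HydrodynamicLimit.Theorems.CollisionRate.stub_fixedTimeVarianceUnitRung0 hPl)

end

end Summit.AtomisticToContinuum.HydrodynamicLimit.Theorems.CollisionRate
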